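import Summits.HodgeConjecture.HodgeConjecture.Theorems.WeilTypeLadderTwistPolarizationClasses
import Summits.HodgeConjecture.HodgeConjecture.Theorems.WeilTypeLadderTwistThreeProducts
import Summits.HodgeConjecture.HodgeConjecture.Theorems.WeilTypeLadderCyclicPrymQuarticCMField
import Literature.AlgebraicGeometry.HodgeTheory.MixedEllipticCurvesProductsHodgeClasses
import Literature.AlgebraicTopology.SingularHomology.FiltrationLefschetzCupGeneration
import HarnessLib

/-!
# Weil-type ladder — THEOREM EXC (iii) in the kernel: a twisting automorphism makes the `K′`-Weil classes DIVISOR POLYNOMIALS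

b2b cell `hweil` (packet `run/shared/lean/b2b/hodge-weil/`), prover 3; report `b2b-hweil-pv3-g46/COMPACT-PAIRS.md` §7
(THEOREM EXC, the seven Rohde-exceptional composite four-point families `(15; 1,4,5,5)`, `(15; 1,9,9,11)`, `(16; 1,3,5,7)`,
`(20; 1,5,5,9)`, `(20; 1,9,15,15)`, `(20; 1,4,4,11)`, `(20; 1,11,14,14)`; Rohde, LNM 1975 Ch. 6 §6.4, "complex case").

SETTING (all binders explicit). `B` a complex abelian EIGHTFOLD, `s : B ⟶ B` with `Φ_m(s) = 0`, `φ(m) = 8` (so `H¹(B(ℂ); ℂ) =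
⊕_c V_c` over the primitive `m`-th roots `c`, `dim V_c = 2`); an AUTOMORPHISM `τ` (left inverse `τ'`) twisting `s` by a unit
`u` of order two, `τ ≫ s = s^u ≫ τ`, `u² ≡ 1`, `u ≢ −1 (mod m)`; a polynomial `Q ∈ ℤ[T]` with `Q(conj(c)^u) = Q(c)` on the
roots (so `θ = Q(s)` generates the quartic CM subfield `K′ = E^{⟨ιu⟩}` of `E = ℚ(ζ_m)`), its minimal polynomial `P`
(monic, irreducible over `ℚ`, degree `4`, `P(θ) = 0`); and a non-degenerate `s`-INVARIANT `ℚ`-bilinear form `ψ` on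
`H¹(B(ℂ); ℚ)`, isotropic on `H^{1,0}` and `H^{0,1}` (a polarization for which `s` is an automorphism).

* `weilClassesField_le_divisorClassesSpan_of_twist` — **`W_{K′} ⊗ ℂ = weilClassesField B θ P 4 ⊆ D²(B) ⊗ ℂ`**: every
  `K′`-Weil class is a polynomial in rational `(1,1)`-classes (hence algebraic by Lefschetz `(1,1)` — corollary
  `weilClassesField_le_algebraicClasses_of_twist` of the companion `…TwistDecomposableInstances`). UNCONDITIONAL: no named fact.

PROOF (report §7 (iii), on the carriers). Fix an `s^*`-eigenbasis `b` of `H¹` (`s^* b_j = λ_j b_j`) and its `Ψ`-dual basis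
`d` (`Ψ = ψ ⊗ ℂ`): `s^* d_j = λ̄_j d_j` (invariance), `s^* τ^* d_j = λ̄_j^u τ^* d_j` (twist). The Casimir classes
`Λ_k = Σ_j (τ ≫ s^k)^* d_j ⌣ b_j = Σ_j λ̄_j^k g_j`, `g_j = τ^* d_j ⌣ b_j`, are rational `(1,1)`-classes
(`…TwistPolarizationClasses`), so `Λ_k ⌣ Λ_l ∈ D² ⊗ ℂ`. For a root `ρ` of `P` the summand `⋀⁴ V_ρ(θ)` of `W_{K′} ⊗ ℂ` is a
LINE `ℂ ω` (tree: `exists_generator_pullbackEigenclasses_of_root`), and `V_ρ(θ) = V_c ⊕ V_μ` for a root `c` with `Q(c) = ρ`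
and `μ = c̄^u ≠ c` (`dim V_ρ(θ) = 4`, `dim V_c = dim V_μ = 2`). A Lagrange projector, polynomial in the rational test
pull-back `(x₀·𝟙 + θ)^*` (which preserves `D²`), cuts `Λ_k ⌣ Λ_l` down to `π₀ · G_k ⌣ G_l`, `π₀ ≠ 0`,
`G_k = c̄^k Y′ + μ̄^k X′` (`Y′ = g_{i₁} + g_{i₂}` over the two indices of `V_c`, `X′ = g_{i₃} + g_{i₄}` over those of `V_μ`),
so `G_k ⌣ G_l ∈ (D² ⊗ ℂ) ∩ ℂω`. Writing `Y′², X′Y′, X′² = α ω, β ω, γ ω` with `γ ≠ 0` (`X′² = 2 · τ^*d_{i₃} ⌣ b_{i₃} ⌣ τ^*d_{i₄} ⌣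
b_{i₄} ≠ 0`, a wedge of four independent classes), the three relations `G_0², G_1², G_0 G_1 ∈ {0}` would force
`(c̄ − μ̄)² γ = 0`; hence some `G_k ⌣ G_l` is a NON-ZERO multiple of `ω` in `D² ⊗ ℂ`, and `ℂ ω ⊆ D² ⊗ ℂ`.

HONEST LABEL: the `K′`-Weil classes of these families are DECOMPOSABLE (products of divisor classes), as the report says; this is
a rung instance only in the weak sense that R3's conclusion holds on these loci WITHOUT any named fact; 0 unconditional rungs
above the floor; nothing of [Mar25]/[Mos26]/[Perry]; Markman-free; no `sorry`, no definition, no named fact.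
[cite: Rohde2009CyclicCoverings, Ch. 6 §6.4 (Lemma 6.4.2, 6.4.4, Thm. 6.4.9, 6.4.10)] [cite: Deligne1982HodgeCycles, §4 (4.4)–(4.5)]
[cite: MoonenZarhin1998WeilClasses, §1 and (4) (decomposable versus exceptional classes)] [cite: vanGeemen1994HodgeAV, §2.4, Thm. 4.11]
-/

noncomputable section

-- every declaration of this problem lives in `Summit.HodgeConjecture.HodgeConjecture.…` (summit = sub-problem)
set_option linter.dupNamespace false

open CategoryTheory Polynomial
open scoped TensorProduct
open Literature.AlgebraicGeometry Literature.AlgebraicGeometry.Motives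
open Literature.AlgebraicGeometry.HodgeTheory
open Literature.AlgebraicTopology.SingularHomology
open Literature.Barriers.HodgeConjecture (divisorClassesSpan)

namespace Summit.HodgeConjecture.HodgeConjecture.WeilTypeLadder

/-- **THEOREM EXC (iii) (kernel form): a twisting automorphism makes the `K′`-Weil classes divisor polynomials.**
See the module docstring for the setting and the proof. [cite: Rohde2009CyclicCoverings, Ch. 6 §6.4]
[cite: Deligne1982HodgeCycles, §4 (4.4)–(4.5)] [cite: MoonenZarhin1998WeilClasses, §1] -/
theorem weilClassesField_le_divisorClassesSpan_of_twist
    (B : AbelianVariety ℂ) (s τ τ' : B ⟶ B) (m u : ℕ) (Q P : Polynomial ℤ)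
    (hm8 : Nat.totient m = 8) (hdim : B.dim = 8)
    (hs : Polynomial.eval₂ (Int.castRingHom (CategoryTheory.End B)) (CategoryTheory.End.of s)
      (Polynomial.cyclotomic m ℤ) = 0)
    (hτ : τ ≫ s = CategoryTheory.End.asHom (CategoryTheory.End.of s ^ u) ≫ τ) (hτ' : τ' ≫ τ = 𝟙 B)
    (hu : u * u ≡ 1 [MOD m]) (hu1 : ¬ m ∣ u + 1)
    (hQ : ∀ c : ℂ, Polynomial.eval₂ (Int.castRingHom ℂ) c (Polynomial.cyclotomic m ℤ) = 0 →
      Polynomial.eval₂ (Int.castRingHom ℂ) (starRingEnd ℂ c ^ u) Q = Polynomial.eval₂ (Int.castRingHom ℂ) c Q)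
    (hPm : P.Monic) (hPe : P.natDegree = 4) (hPirr : Irreducible (P.map (Int.castRingHom ℚ)))
    (hPθ : Polynomial.eval₂ (Int.castRingHom (CategoryTheory.End B))
      ((CategoryTheory.End.asHom (Polynomial.eval₂ (Int.castRingHom (CategoryTheory.End B))
        (CategoryTheory.End.of s) Q) : B ⟶ B) : CategoryTheory.End B) P = 0)
    (ψ : LinearMap.BilinForm ℚ (bettiCohomology B.X 1)) (hψ : ψ.Nondegenerate)
    (hψs : ∀ x y : bettiCohomology B.X 1,
      ψ ((bettiCohomology.map s.hom.hom.hom 1).hom x) ((bettiCohomology.map s.hom.hom.hom 1).hom y) = ψ x y)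
    (hψ10 : ∀ x y : ℂ ⊗[ℚ] bettiCohomology B.X 1,
      ofRatClassBaseChange (Motives.ComplexPoints B.X) 1 x ∈
          hodgeOneZero (AbelianVariety.isSmoothProjective_holds (A := B)) →
        ofRatClassBaseChange (Motives.ComplexPoints B.X) 1 y ∈
          hodgeOneZero (AbelianVariety.isSmoothProjective_holds (A := B)) → ψ.baseChange ℂ x y = 0)
    (hψ01 : ∀ x y : ℂ ⊗[ℚ] bettiCohomology B.X 1,
      ofRatClassBaseChange (Motives.ComplexPoints B.X) 1 x ∈
          hodgeZeroOne (AbelianVariety.isSmoothProjective_holds (A := B)) →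
        ofRatClassBaseChange (Motives.ComplexPoints B.X) 1 y ∈
          hodgeZeroOne (AbelianVariety.isSmoothProjective_holds (A := B)) → ψ.baseChange ℂ x y = 0) :
    weilClassesField B (CategoryTheory.End.asHom (Polynomial.eval₂ (Int.castRingHom (CategoryTheory.End B))
        (CategoryTheory.End.of s) Q)) P 4 ≤ divisorClassesSpan B.X B.dim 2 := by
  classical
  have hX : IsSmoothProjective B.dim B.X := AbelianVariety.isSmoothProjective_holds (A := B)
  haveI := finite_complexBetti_abelianVariety B 1
  set θ : B ⟶ B := CategoryTheory.End.asHom (Polynomial.eval₂ (Int.castRingHom (CategoryTheory.End B))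
    (CategoryTheory.End.of s) Q) with hθdef
  set T : Module.End ℂ (complexBetti B.X 1) := (complexBetti.map s.hom.hom.hom 1).hom with hTdef
  set Θ : Module.End ℂ (complexBetti B.X 1) := (complexBetti.map θ.hom.hom.hom 1).hom with hΘdef
  set U : Module.End ℂ (complexBetti B.X 1) := (complexBetti.map τ.hom.hom.hom 1).hom with hUdef
  set QC : Polynomial ℂ := Q.map (Int.castRingHom ℂ) with hQCdef
  /- (0) arithmetic of `m`, `Φ_m`, its roots, `s^m = 1` -/
  have hm2 : 2 ≤ m := by
    by_contra h
    interval_cases m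
    · rw [Nat.totient_zero] at hm8; exact absurd hm8 (by norm_num)
    · rw [Nat.totient_one] at hm8; exact absurd hm8 (by norm_num)
  have hm0 : 0 < m := by omega
  have hΦm : (Polynomial.cyclotomic m ℤ).Monic := Polynomial.cyclotomic.monic m ℤ
  have hΦe : (Polynomial.cyclotomic m ℤ).natDegree = 8 := by rw [Polynomial.natDegree_cyclotomic, hm8]
  have hΦirr : Irreducible ((Polynomial.cyclotomic m ℤ).map (Int.castRingHom ℚ)) := by
    rw [Polynomial.map_cyclotomic_int]; exact Polynomial.cyclotomic.irreducible_rat hm0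
  have hroot : ∀ c : ℂ, Polynomial.eval₂ (Int.castRingHom ℂ) c (Polynomial.cyclotomic m ℤ) = 0 →
      IsPrimitiveRoot c m := fun c hc => isPrimitiveRoot_of_eval₂_cyclotomic hm0.ne' hc
  have hroot' : ∀ c : ℂ, IsPrimitiveRoot c m →
      Polynomial.eval₂ (Int.castRingHom ℂ) c (Polynomial.cyclotomic m ℤ) = 0 := by
    intro c hc
    haveI : NeZero (m : ℂ) := ⟨Nat.cast_ne_zero.2 hm0.ne'⟩
    rw [Polynomial.eval₂_eq_eval_map, Polynomial.map_cyclotomic_int]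
    exact Polynomial.isRoot_cyclotomic_iff.2 hc
  have hQCeval : ∀ c : ℂ, QC.eval c = Polynomial.eval₂ (Int.castRingHom ℂ) c Q := fun c => Polynomial.eval_map _ _
  have hsm : CategoryTheory.End.of s ^ m = 1 := pow_eq_one_of_eval₂_cyclotomic _ hs
  have hTm : T ^ m = 1 := by
    rw [hTdef, ← hom_complexBetti_map_pow_one s m, hsm]
    ext c
    exact abelianVariety_map_id_apply (A := B) c
  /- `τ^* ∘ s^* = (s^*)^u ∘ τ^*`, `τ^*` injective, `θ^* = Q(s^*)` -/
  have hUT : ∀ x, U (T x) = (T ^ u) (U x) := by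
    intro x
    rw [hTdef, ← hom_complexBetti_map_pow_one s u, hUdef]
    change singularCohomology.map ℂ ℂ (Motives.AlgPoints.mapContinuous (L := ℂ) τ.hom.hom.hom) 1
        (singularCohomology.map ℂ ℂ (Motives.AlgPoints.mapContinuous (L := ℂ) s.hom.hom.hom) 1 x) =
      singularCohomology.map ℂ ℂ (Motives.AlgPoints.mapContinuous (L := ℂ)
          (CategoryTheory.End.asHom (CategoryTheory.End.of s ^ u)).hom.hom.hom) 1
        (singularCohomology.map ℂ ℂ (Motives.AlgPoints.mapContinuous (L := ℂ) τ.hom.hom.hom) 1 x)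
    rw [abelianVariety_map_map_apply, abelianVariety_map_map_apply, hτ]
  have hUinj : Function.Injective U := by
    intro x y hxy
    have h := congrArg (singularCohomology.map ℂ ℂ (Motives.AlgPoints.mapContinuous (L := ℂ) τ'.hom.hom.hom) 1) hxy
    change singularCohomology.map ℂ ℂ (Motives.AlgPoints.mapContinuous (L := ℂ) τ'.hom.hom.hom) 1
        (singularCohomology.map ℂ ℂ (Motives.AlgPoints.mapContinuous (L := ℂ) τ.hom.hom.hom) 1 x) =
      singularCohomology.map ℂ ℂ (Motives.AlgPoints.mapContinuous (L := ℂ) τ'.hom.hom.hom) 1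
        (singularCohomology.map ℂ ℂ (Motives.AlgPoints.mapContinuous (L := ℂ) τ.hom.hom.hom) 1 y) at h
    rwa [abelianVariety_map_map_apply, abelianVariety_map_map_apply, hτ', abelianVariety_map_id_apply,
      abelianVariety_map_id_apply] at h
  have hΘ : Θ = Polynomial.aeval T QC := hom_complexBetti_map_eval₂_one s Q
  /- (1) an `s^*`-eigenbasis `b`, its `Ψ`-dual basis `d`, eigenvalues -/
  obtain ⟨N, b, lam, hlamΦ, hbmem⟩ := exists_eigenbasis_complexBetti_one (A := B) (φ := s) hΦirr hs
  have hb : ∀ j, T (b j) = lam j • b j := fun j => Module.End.mem_eigenspace_iff.1 (hbmem j)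
  have hlam : ∀ j, IsPrimitiveRoot (lam j) m := fun j => hroot _ (hlamΦ j)
  have hcard : ∀ c : ℂ, Polynomial.eval₂ (Int.castRingHom ℂ) c (Polynomial.cyclotomic m ℤ) = 0 →
      (Finset.univ.filter fun j => lam j = c).card = 2 := by
    intro c hc
    rw [← finrank_eigenspace_eq_card b T lam hb c]
    exact finrank_eigenspace_eq_of_root hΦm hΦe hΦirr hs (by rw [hdim]) hc
  set Ψ := LinearMap.BilinForm.congr (ofRatClassBaseChangeEquiv hX 1) (ψ.baseChange ℂ) with hΨdef
  have hΨ : Ψ.Nondegenerate := congrForm_nondegenerate hX ψ hψ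
  have hΨT : ∀ x y, Ψ (T x) (T y) = Ψ x y := fun x y => congrForm_map_map hX ψ s hψs x y
  obtain ⟨d, hdd⟩ : ∃ d : Module.Basis (Fin N) ℂ (complexBetti B.X 1), d = Ψ.dualBasis hΨ b := ⟨_, rfl⟩
  have hd : ∀ j, T (d j) = starRingEnd ℂ (lam j) • d j := by
    intro j
    rw [(conj_eq_pow_of_isPrimitiveRoot hm0 (hlam j)).2.2, hdd]
    exact apply_dualBasis_eq_pow_smul Ψ hΨ T hΨT hm0 hTm b lam hb j
  have hUd : ∀ j, T (U (d j)) = (starRingEnd ℂ (lam j) ^ u) • U (d j) := by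
    intro j
    obtain ⟨k, hk⟩ := exists_mul_self_eq_of_modEq hm2 hu
    have h1 : T = (T ^ u) ^ u := by
      rw [← pow_mul, hk, pow_add, pow_mul, hTm, one_pow, one_mul, pow_one]
    have h2 : (T ^ u) (U (d j)) = starRingEnd ℂ (lam j) • U (d j) := by rw [← hUT, hd, map_smul]
    conv_lhs => rw [h1]
    exact pow_apply_of_apply_eq_smul (T ^ u) h2 u
  have hΘb : ∀ j, Θ (b j) = QC.eval (lam j) • b j := fun j => by
    rw [hΘ]; exact aeval_apply_of_eq_smul T QC (hb j)
  have hΘUd : ∀ j, Θ (U (d j)) = QC.eval (lam j) • U (d j) := fun j => by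
    rw [hΘ, aeval_apply_of_eq_smul T QC (hUd j), hQCeval, hQCeval, hQ _ (hlamΦ j)]
  /- (2) the divisor classes `Λ_k = Σ_j λ̄_j^k g_j`, `g_j = τ^* d_j ⌣ b_j`, and their products -/
  obtain ⟨g, hg⟩ : ∃ g : Fin N → complexBetti B.X 2,
      ∀ j, g j = cupPowOne ℂ (Motives.ComplexPoints B.X) 2 ![U (d j), b j] := ⟨_, fun j => rfl⟩
  have hΛ : ∀ k : ℕ, (∑ j, (starRingEnd ℂ (lam j) ^ k) • g j) ∈ divisorClassesSpan B.X B.dim 1 := by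
    intro k
    have h := casimirSum_mem_divisorClassesSpan_one hX ψ hψ hψ10 hψ01 Ψ rfl hΨ b
      (τ ≫ CategoryTheory.End.asHom (CategoryTheory.End.of s ^ k))
    rw [← hdd] at h
    have hterm : ∀ j, cupProduct (Nat.add_comm 1 1)
        (complexBetti.map (τ ≫ CategoryTheory.End.asHom (CategoryTheory.End.of s ^ k)).hom.hom.hom 1 (d j))
          (b j) = (starRingEnd ℂ (lam j) ^ k) • g j := by
      intro j
      have hpull : complexBetti.map (τ ≫ CategoryTheory.End.asHom (CategoryTheory.End.of s ^ k)).hom.hom.hom 1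
          (d j) = (starRingEnd ℂ (lam j) ^ k) • U (d j) := by
        change singularCohomology.map ℂ ℂ (Motives.AlgPoints.mapContinuous (L := ℂ)
          (τ ≫ CategoryTheory.End.asHom (CategoryTheory.End.of s ^ k)).hom.hom.hom) 1 (d j) = _
        rw [← abelianVariety_map_map_apply]
        change U ((complexBetti.map (CategoryTheory.End.asHom (CategoryTheory.End.of s ^ k)).hom.hom.hom 1).hom
          (d j)) = _
        rw [hom_complexBetti_map_pow_one, pow_apply_of_apply_eq_smul T (hd j) k, map_smul]
      rw [hpull, map_smul, LinearMap.smul_apply, hg, cupPowOne_two]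
      rfl
    simp only [hterm] at h
    exact h
  have hΛΛ : ∀ k l : ℕ, cupProduct (rfl : 2 + 2 = 4) (∑ j, (starRingEnd ℂ (lam j) ^ k) • g j)
      (∑ j, (starRingEnd ℂ (lam j) ^ l) • g j) ∈ divisorClassesSpan B.X B.dim 2 := fun k l =>
    cupProduct_mem_divisorClassesSpan_of_mem (X := B.X) (N := B.dim) (rfl : 1 + 1 = 2)
      (rfl : 2 * 1 + 2 * 1 = 2 * 2) (hΛ k) (hΛ l)
  obtain ⟨w, hw⟩ : ∃ w : Fin N → Fin N → complexBetti B.X 4,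
      ∀ j j', w j j' = cupPowOne ℂ (Motives.ComplexPoints B.X) 4 ![U (d j), b j, U (d j'), b j'] :=
    ⟨_, fun j j' => rfl⟩
  have hgg : ∀ j j', cupProduct (rfl : 2 + 2 = 4) (g j) (g j') = w j j' := fun j j' => by
    rw [hg, hg, hw]; exact cupProduct_cupPowOne_two_two _ _ _ _
  have hexpand : ∀ (A : Finset (Fin N)) (α β : Fin N → ℂ),
      cupProduct (rfl : 2 + 2 = 4) (∑ j ∈ A, α j • g j) (∑ j' ∈ A, β j' • g j') =
        ∑ j ∈ A, ∑ j' ∈ A, (α j * β j') • w j j' := by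
    intro A α β
    rw [cupProduct_sum_smul_sum_smul]
    simp only [hgg]
  /- (3) the summand of `W_{K′} ⊗ ℂ` at a root `ρ` of `P`: a line `ℂ ω`; its index set `J = I_c ∪ I_μ` -/
  refine iSup₂_le fun ρ hρ => ?_
  change Polynomial.eval₂ (Int.castRingHom ℂ) ρ P = 0 at hρ
  obtain ⟨ω, -, -, -, hωgen⟩ :=
    exists_generator_pullbackEigenclasses_of_root (A := B) (φ := θ) (r := 4) hPm hPe hPirr hPθ (by rw [hdim]) hρ
  set L := pullbackEigenclasses B θ 4 (fun x y => ((x : ℂ) + (y : ℂ) * ρ) ^ 4) with hLdef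
  set J : Finset (Fin N) := Finset.univ.filter fun j => QC.eval (lam j) = ρ with hJdef
  have hJmem : ∀ j, j ∈ J ↔ QC.eval (lam j) = ρ := fun j => by simp [hJdef]
  have hJcard : J.card = 4 := by
    rw [hJdef, ← finrank_eigenspace_eq_card b Θ (fun j => QC.eval (lam j)) hΘb ρ]
    exact finrank_eigenspace_eq_of_root hPm hPe hPirr hPθ (by rw [hdim]) hρ
  obtain ⟨j₀, hj₀⟩ : J.Nonempty := by rw [← Finset.card_pos, hJcard]; norm_num
  obtain ⟨c, hcdef⟩ : ∃ c : ℂ, c = lam j₀ := ⟨_, rfl⟩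
  have hcρ : QC.eval c = ρ := by rw [hcdef]; exact (hJmem j₀).1 hj₀
  have hcprim : IsPrimitiveRoot c m := by rw [hcdef]; exact hlam j₀
  have hcΦ : Polynomial.eval₂ (Int.castRingHom ℂ) c (Polynomial.cyclotomic m ℤ) = 0 := hroot' c hcprim
  obtain ⟨hc0, hcinv, -⟩ := conj_eq_pow_of_isPrimitiveRoot hm0 hcprim
  obtain ⟨μ, hμdef⟩ : ∃ μ : ℂ, μ = starRingEnd ℂ c ^ u := ⟨_, rfl⟩
  obtain ⟨hμu, hμprim⟩ := conj_pow_conj_pow hm2 hu hcprim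
  rw [← hμdef] at hμu hμprim
  have hμΦ : Polynomial.eval₂ (Int.castRingHom ℂ) μ (Polynomial.cyclotomic m ℤ) = 0 := hroot' μ hμprim
  have hμρ : QC.eval μ = ρ := by rw [hμdef, hQCeval, hQ _ hcΦ, ← hQCeval]; exact hcρ
  have hμc : μ ≠ c := by
    intro h
    apply hu1
    rw [← hcprim.pow_eq_one_iff_dvd]
    calc c ^ (u + 1) = c ^ u * c := pow_succ c u
      _ = c ^ u * starRingEnd ℂ c ^ u := by rw [← hμdef, h]
      _ = (c * starRingEnd ℂ c) ^ u := (mul_pow _ _ _).symm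
      _ = 1 := by rw [hcinv, mul_inv_cancel₀ hc0, one_pow]
  have hcμbar : starRingEnd ℂ c ≠ starRingEnd ℂ μ := fun h => hμc ((starRingEnd ℂ).injective h).symm
  set Ic : Finset (Fin N) := Finset.univ.filter fun j => lam j = c with hIcdef
  set Iμ : Finset (Fin N) := Finset.univ.filter fun j => lam j = μ with hIμdef
  have hIc2 : Ic.card = 2 := hcard c hcΦ
  have hIμ2 : Iμ.card = 2 := hcard μ hμΦ
  have hdisj : Disjoint Ic Iμ := by
    rw [hIcdef, hIμdef, Finset.disjoint_filter]
    intro j _ h1 h2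
    exact hμc (h2.symm.trans h1)
  have hsub : Ic ∪ Iμ ⊆ J := by
    intro j hj
    rw [Finset.mem_union] at hj
    rw [hJmem]
    rcases hj with h | h
    · rw [(Finset.mem_filter.1 h).2]; exact hcρ
    · rw [(Finset.mem_filter.1 h).2]; exact hμρ
  have hJeq : Ic ∪ Iμ = J := Finset.eq_of_subset_of_card_le hsub
    (by rw [Finset.card_union_of_disjoint hdisj, hIc2, hIμ2, hJcard])
  obtain ⟨i₁, i₂, h12, hIc12⟩ := Finset.card_eq_two.1 hIc2
  obtain ⟨i₃, i₄, h34, hIμ34⟩ := Finset.card_eq_two.1 hIμ2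
  have hl1 : lam i₁ = c := (Finset.mem_filter.1 (show i₁ ∈ Ic by rw [hIc12]; simp)).2
  have hl2 : lam i₂ = c := (Finset.mem_filter.1 (show i₂ ∈ Ic by rw [hIc12]; simp)).2
  have hl3 : lam i₃ = μ := (Finset.mem_filter.1 (show i₃ ∈ Iμ by rw [hIμ34]; simp)).2
  have hl4 : lam i₄ = μ := (Finset.mem_filter.1 (show i₄ ∈ Iμ by rw [hIμ34]; simp)).2
  have hq1 : QC.eval (lam i₁) = ρ := by rw [hl1]; exact hcρ
  have hq2 : QC.eval (lam i₂) = ρ := by rw [hl2]; exact hcρ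
  have hq3 : QC.eval (lam i₃) = ρ := by rw [hl3]; exact hμρ
  have hq4 : QC.eval (lam i₄) = ρ := by rw [hl4]; exact hμρ
  /- (4) `G_k = Σ_{j ∈ J} λ̄_j^k g_j = c̄^k Y′ + μ̄^k X′`; the products `Y′², X′Y′, X′²` lie on the line -/
  obtain ⟨Y', hY'def⟩ : ∃ Y' : complexBetti B.X 2, Y' = g i₁ + g i₂ := ⟨_, rfl⟩
  obtain ⟨X', hX'def⟩ : ∃ X' : complexBetti B.X 2, X' = g i₃ + g i₄ := ⟨_, rfl⟩
  have hG : ∀ k : ℕ, ∑ j ∈ J, (starRingEnd ℂ (lam j) ^ k) • g j =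
      (starRingEnd ℂ c ^ k) • Y' + (starRingEnd ℂ μ ^ k) • X' := by
    intro k
    rw [← hJeq, Finset.sum_union hdisj, hIc12, hIμ34, Finset.sum_pair h12, Finset.sum_pair h34, hl1, hl2, hl3, hl4,
      hY'def, hX'def, smul_add, smul_add]
  have hline : ∀ j j', QC.eval (lam j) = ρ → QC.eval (lam j') = ρ → w j j' ∈ L := by
    intro j j' hj hj'
    rw [hw, hLdef]
    apply cupPowOne_mem_pullbackEigenclasses_pow θ
    refine forall_vecCons_four (Module.End.eigenspace Θ ρ : Set (complexBetti B.X 1)) ?_ ?_ ?_ ?_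
    · exact Module.End.mem_eigenspace_iff.2 (by rw [← hj]; exact hΘUd j)
    · exact Module.End.mem_eigenspace_iff.2 (by rw [← hj]; exact hΘb j)
    · exact Module.End.mem_eigenspace_iff.2 (by rw [← hj']; exact hΘUd j')
    · exact Module.End.mem_eigenspace_iff.2 (by rw [← hj']; exact hΘb j')
  have hpair : ∀ {p q p' q' : Fin N}, QC.eval (lam p) = ρ → QC.eval (lam q) = ρ → QC.eval (lam p') = ρ →
      QC.eval (lam q') = ρ → cupProduct (rfl : 2 + 2 = 4) (g p + g q) (g p' + g q') ∈ L := by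
    intro p q p' q' hp hq hp' hq'
    simp only [map_add, LinearMap.add_apply, hgg]
    exact L.add_mem (L.add_mem (hline _ _ hp hp') (hline _ _ hq hp')) (L.add_mem (hline _ _ hp hq') (hline _ _ hq hq'))
  have hYYmem : cupProduct (rfl : 2 + 2 = 4) Y' Y' ∈ L := by rw [hY'def]; exact hpair hq1 hq2 hq1 hq2
  have hXYmem : cupProduct (rfl : 2 + 2 = 4) X' Y' ∈ L := by rw [hX'def, hY'def]; exact hpair hq3 hq4 hq1 hq2
  have hXXmem : cupProduct (rfl : 2 + 2 = 4) X' X' ∈ L := by rw [hX'def]; exact hpair hq3 hq4 hq3 hq4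
  obtain ⟨α, hα⟩ := hωgen _ hYYmem
  obtain ⟨β, hβ⟩ := hωgen _ hXYmem
  obtain ⟨γ, hγ⟩ := hωgen _ hXXmem
  have hYX : cupProduct (rfl : 2 + 2 = 4) Y' X' = β • ω := by rw [cupProduct_comm_two_two]; exact hβ
  -- `X′ ⌣ X′ = 2 · w i₃ i₄ ≠ 0`
  have hXX : cupProduct (rfl : 2 + 2 = 4) X' X' = (2 : ℂ) • w i₃ i₄ := by
    rw [hX'def]
    simp only [map_add, LinearMap.add_apply, hgg]
    rw [hw, hw, hw, hw, cupPowOne_four_eq_zero_of_repeat, cupPowOne_four_eq_zero_of_repeat,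
      cupPowOne_four_swap_pairs (U (d i₃)) (b i₃) (U (d i₄)) (b i₄), zero_add, add_zero, two_smul]
  have hw34 : w i₃ i₄ ≠ 0 := by
    rw [hw]
    refine cupPowOne_ne_zero_of_linearIndependent B
      (linearIndependent_four_of_disjoint (Module.End.eigenspace T c) (Module.End.eigenspace T μ)
        ((Module.End.eigenspaces_iSupIndep T).pairwiseDisjoint hμc.symm) ?_ ?_ ?_ ?_
        (linearIndependent_pair_map (linearIndependent_basis_pair d h34) U hUinj)
        (linearIndependent_basis_pair b h34))
    · rw [Module.End.mem_eigenspace_iff, hUd, hl3, hμu]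
    · rw [Module.End.mem_eigenspace_iff, hUd, hl4, hμu]
    · rw [Module.End.mem_eigenspace_iff, hb, hl3]
    · rw [Module.End.mem_eigenspace_iff, hb, hl4]
  have hγ0 : γ ≠ 0 := by
    intro h0
    rw [h0, zero_smul, hXX] at hγ
    exact hw34 ((smul_eq_zero.1 hγ).resolve_left two_ne_zero)
  /- (5) the Lagrange projector in the test pull-back `(x₀·𝟙 + θ)^*` -/
  obtain ⟨x₀, hx₀⟩ := exists_nat_separating_prod (fun j : Fin N => QC.eval (lam j)) ({ρ} : Finset ℂ) 4
  set T₀ : Module.End ℂ (complexBetti B.X 4) := (complexBetti.map (x₀ • 𝟙 B + (1 : ℕ) • θ).hom.hom.hom 4).hom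
    with hT₀def
  obtain ⟨tv, htv⟩ : ∃ tv : Fin N → Fin N → ℂ, ∀ j j', tv j j' = ∏ i : Fin 4,
      ((x₀ : ℂ) + (![QC.eval (lam j), QC.eval (lam j), QC.eval (lam j'), QC.eval (lam j')] : Fin 4 → ℂ) i) :=
    ⟨_, fun j j' => rfl⟩
  have hT₀w : ∀ j j', T₀ (w j j') = tv j j' • w j j' := by
    intro j j'
    rw [hw, htv]
    refine map_cupPowOne_four_of_mem_eigenspace θ x₀ _ _ fun i => ?_
    fin_cases i
    · exact Module.End.mem_eigenspace_iff.2 (hΘUd j)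
    · exact Module.End.mem_eigenspace_iff.2 (hΘb j)
    · exact Module.End.mem_eigenspace_iff.2 (hΘUd j')
    · exact Module.End.mem_eigenspace_iff.2 (hΘb j')
  have htv4 : ∀ j j', tv j j' =
      ((x₀ : ℂ) + QC.eval (lam j)) * ((x₀ : ℂ) + QC.eval (lam j)) *
        (((x₀ : ℂ) + QC.eval (lam j')) * ((x₀ : ℂ) + QC.eval (lam j'))) := by
    intro j j'
    rw [htv, Fin.prod_univ_four]
    simp only [Matrix.cons_val_zero, Matrix.cons_val_one, Matrix.cons_val]
    ring
  have htvρ : ∀ j j', tv j j' = ((x₀ : ℂ) + ρ) ^ 4 → QC.eval (lam j) = ρ ∧ QC.eval (lam j') = ρ := by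
    intro j j' h
    have h' := hx₀ ![j, j, j', j'] ρ (Finset.mem_singleton_self ρ) (by
      rw [← h, htv4, Fin.prod_univ_four]
      simp only [Matrix.cons_val_zero, Matrix.cons_val_one, Matrix.cons_val]
      ring)
    exact ⟨by simpa using h' 0, by simpa using h' 2⟩
  have htvρ' : ∀ j j', QC.eval (lam j) = ρ → QC.eval (lam j') = ρ → tv j j' = ((x₀ : ℂ) + ρ) ^ 4 := by
    intro j j' hj hj'
    rw [htv4, hj, hj']
    ring
  set tρ : ℂ := ((x₀ : ℂ) + ρ) ^ 4 with htρdef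
  set Tset : Finset ℂ := ((Finset.univ : Finset (Fin N × Fin N)).image fun jj => tv jj.1 jj.2).erase tρ
    with hTset
  set pr : Polynomial ℂ := ∏ t ∈ Tset, (X - C t) with hprdef
  set π₀ : ℂ := ∏ t ∈ Tset, (tρ - t) with hπ₀def
  have hπ₀ : π₀ ≠ 0 :=
    Finset.prod_ne_zero_iff.2 fun t ht => sub_ne_zero.2 (Finset.ne_of_mem_erase ht).symm
  have hpreval : ∀ z : ℂ, pr.eval z = ∏ t ∈ Tset, (z - t) := by
    intro z
    rw [hprdef, Polynomial.eval_prod]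
    exact Finset.prod_congr rfl fun t _ => by rw [Polynomial.eval_sub, Polynomial.eval_X, Polynomial.eval_C]
  have hprJ : ∀ j j', j ∈ J → j' ∈ J → Polynomial.aeval T₀ pr (w j j') = π₀ • w j j' := by
    intro j j' hj hj'
    rw [aeval_apply_of_eq_smul T₀ pr (hT₀w j j'), htvρ' j j' ((hJmem j).1 hj) ((hJmem j').1 hj'), hpreval]
  have hpr0 : ∀ j j', ¬ (j ∈ J ∧ j' ∈ J) → Polynomial.aeval T₀ pr (w j j') = 0 := by
    intro j j' hjj
    have hne : tv j j' ≠ tρ := fun h => hjj (by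
      obtain ⟨h1, h2⟩ := htvρ j j' h
      exact ⟨(hJmem j).2 h1, (hJmem j').2 h2⟩)
    have hmem : tv j j' ∈ Tset :=
      Finset.mem_erase.2 ⟨hne, Finset.mem_image.2 ⟨(j, j'), Finset.mem_univ _, rfl⟩⟩
    rw [aeval_apply_of_eq_smul T₀ pr (hT₀w j j'), hpreval, Finset.prod_eq_zero hmem (sub_self _), zero_smul]
  -- the projector cuts `Λ_k ⌣ Λ_l` down to `π₀ · G_k ⌣ G_l`, inside `D²`
  have hmem : ∀ k l : ℕ, π₀ • cupProduct (rfl : 2 + 2 = 4)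
      ((starRingEnd ℂ c ^ k) • Y' + (starRingEnd ℂ μ ^ k) • X') ((starRingEnd ℂ c ^ l) • Y' + (starRingEnd ℂ μ ^ l) • X')
      ∈ divisorClassesSpan B.X B.dim 2 := by
    intro k l
    have h := aeval_map_mem_divisorClassesSpan (x₀ • 𝟙 B + (1 : ℕ) • θ) pr (hΛΛ k l)
    change Polynomial.aeval T₀ pr (cupProduct (rfl : 2 + 2 = 4) (∑ j, (starRingEnd ℂ (lam j) ^ k) • g j)
      (∑ j, (starRingEnd ℂ (lam j) ^ l) • g j)) ∈ divisorClassesSpan B.X B.dim 2 at h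
    rw [hexpand Finset.univ, apply_double_sum_eq_smul_sum (Polynomial.aeval T₀ pr) w J π₀ hprJ hpr0,
      ← hexpand J, hG k, hG l] at h
    exact h
  /- (6) one of `G_0 ⌣ G_0`, `G_1 ⌣ G_1`, `G_0 ⌣ G_1` is a non-zero multiple of `ω`, so `ℂ ω ⊆ D²` -/
  have hωD : ω ∈ divisorClassesSpan B.X B.dim 2 :=
    mem_of_three_products (cupProduct (rfl : 2 + 2 = 4)) _ hα hβ hYX hγ hγ0 hcμbar hπ₀ hmem
  intro x hx
  obtain ⟨t, rfl⟩ := hωgen x hx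
  exact Submodule.smul_mem _ t hωD

end Summit.HodgeConjecture.HodgeConjecture.WeilTypeLadder

end
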